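import Literature.MathematicalPhysics.QuantumFieldTheory.Balaban1983to89.B9SmoothHolderClassK

/-!
# `Balaban1983to89.B9GradViaDivLettersSmoothTerms` — THE TERMS OF THE KINEMATIC LETTER `J_μ(U)` (sites → bonds) BETWEEN THE SMOOTH-PARTITION HÖLDER CLASSES
# (file 1 of 2: the value, the pair term, the weight and level bookkeeping, the geometry of one contribution; the `HasMaj` assembly is `B9GradViaDivLettersSmooth`)

T. Bałaban, *Propagators for lattice gauge theories in a background field*, Commun. Math. Phys. **99** (1985) 389–434
[`Balaban1985BackgroundPropagators`, "B9"]; [4] = T. Bałaban, *Propagators and renormalization transformations for lattice gauge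
theories. II*, Commun. Math. Phys. **96** (1984) 223–250 [`Balaban1984PropagatorsII`].

statement-level skeleton of published theorems with citation tags; proofs where landed; nothing here is a claim about the
Yang–Mills mass gap

THE PRINTED LOCI.  [B9] (3.3) p. 390 (`∇_{U,μ}Φ(z) = R(U_μ(z))Φ(z + e_μ) − Φ(z)`), (3.35) p. 396 (the small-field regularity of `U`), (3.40) p. 397 (the Hölder quotient),
(3.43)–(3.45) p. 398 and the remark after (3.47) (*"λ replaced by a function J defined at bonds"*, *"invariant with respect to gauge transformations"*);
[4] (2.51)–(2.54) p. 232, (2.137) p. 247.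

WHY THIS FILE (cell `pub-ymgap`, node N06, seat dag-n06-l g20; sixth piece of the (F1) programme; HOME `F1-SMOOTH-CLASS-MEMO.md` §3–§4: «n06-l's share on the day the class
exists: the J-letter in bHζ»).  n06-l g17∕g18 factored def-Y's gauge-sector `D_U` through the letters `J_μ(U) : sites → bonds` (`JcoKH`, `gradY = Σ_μ cdsB_μ ∘ J_μ`) and
proved `J_μ` between n06-d's SHARP flat Hölder classes `bHS ε → bHK ε` (p620780) — a currency in which no Hölder intermediate `bH13` is producible (SHARP-CUT JUMPS).  THIS
PAIR OF FILES re-sources the letter at the SMOOTH classes of `B9SmoothHolderClassS ∕ K`: ★★ `hasMaj_JcoKH_smooth` (file 2) —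
`HasMaj (bHZ i hε0 hε1 hεp) (bHZK i hε0 hε1 hεp) (JcoKH i b B cfg μ U₁) (fun y y′ => cR39 b·CJZ ℓ p ϑ·e^{δ·rZ d ℓ r}·e^{−δ·d(y,y′)})`, `CJZ = L^{4p} + 2ϑL² + 2L + 1`,
`rZ = 2r + 2·rJ`, every `δ ≥ 0`, under: 1-faithful direction-blind `bI` (`hβ1`, `hbI0` — certificate binders), contracting links `hU`, `0 ≤ ε ≤ 1`, `ε ≤ p`, the ξ-scale
small-gauge binder `hΘ : t^{−ε}·‖U_μ(s) − U_μ(s′)‖ ≤ ϑ` on admissible same-direction pairs (p620780's — it SUFFICES at the η-scale pair weight BECAUSE the sup weight is the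
scale-covariant `(Lʲη)^{−p}`, `p ≥ ε`), and the displayed radius `hN : NearY i y z → d(y, sIK bI z) ≤ r` (n06-w6's LAYER B).
THIS FILE (the terms; for `λ` vanishing off `Δ̃(y′)`, `S′ :=` its `Δ̃(y′)`-sup, `H′ :=` its near-pair part, `W′ := (L^{j(y′)}η)^{−p}`, `loc_{y′} λ = W′S′ + H′`):
* §1 scalars: `readZ` (the read site `chart(b₋ + e_μ)`), `levY_src_read`, `blkV1_level_eq_levY`, `Wscl_le_of_lvl_le` (`Wscl p y ≤ L^{kp}·Wscl p y′` over k levels), `pow_weight_le_Wscl`;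
* §2 VALUE ★`abs_J_le_SupZ`: `|J_μλ(b)| ≤ cR39·S′` (it reads `λ` at `chart(b₋ + e_μ)` only; `abs_JcoKH_apply_le`), and `≠ 0` only if that site lies in `Δ̃(y′)`;
  (`SupZ`, `PairZ`, `bHZ_loc_eq : loc_{y′} = W′·SupZ + PairZ`, `nearY_read_of_J_ne_zero`); ★`weight_mul_abs_sub_le` (ONE SITE PAIR TERM `≤ PairZ + 2L·W′·SupZ`);
* PAIR (file 2; admissible distinct bonds `⟨x,μ⟩, ⟨x′,μ⟩`, same slot; `abs_JcoKH_sub_le`): weight × transport variation `≤ 2ϑ·L²·W′` (`hΘ`, `|lev x − j(y′)| ≤ 2`) times `|κ|S′`, plus the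
  shifted difference — a near site pair based in `Δ̃(y′)` (`≤ H′` per coordinate) or a far∕off pair (weight `≤ L·W′`, difference `≤ 2S′`): in all `≤ cR39·((2ϑL² + 2L)·W′S′ + H′)`;
* §3 `CJZ`, `rZ` and ★`dist_lvl_of_seen`: if anything is seen from `Δ̃(y)` then `d(y, y′) ≤ rZ = 2r + 2rJ` (`hN` twice, `near_dist_carrier_le`, `dist_bI_sIK_shift_le`) and
  `j(y′) ≤ j(y) + 4` (levels of `y`, the base bond, its admissible partner, the read site, `y′` differ by ≤ 1 each).
HONEST SCOPE.  Finite-dimensional bookkeeping; `hΘ` is a DISPLAYED gauge-variant binder (GAUGE-VARIANCE-MEMO: flat classes), `hN` a displayed radius; nothing of [B9]∕[4] asserted;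
no pin of any certificate binder, no certificate edit; COUNT-NEUTRAL; N06 NOT discharged; nothing continuum, nothing about the mass gap.  Cell `pub-ymgap` (HUMAN RULING D-0062),
Track A node N06 [B9], seat `pub-ymgap-dag-n06-l` (g20), 2026-08-28.
-/

noncomputable section

namespace Literature.MathematicalPhysics.QuantumFieldTheory.Balaban1983to89.B9GradViaDivLettersSmoothTerms

open LatticeFieldCalculus (supDist)
open B4TorusKernel.MultiPeriod (torusSupNorm torusSupNorm_nonneg)
open B6MultiLevelTorusOperator (one_le_N0)
open B6Geom246MultiLevelBox (blkOf)
open B6Geom246MultiLevelTorus (geomT bondT triangle_refl_nonneg_T)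
open B6GlobalChartV1 (PV blkV1)
open B6Ineq2142KLevelV1 (β lvl)
open B6KLevelCensusIndexV1 (KIdx Adm tpar kGeo)
open B6Prop22KLevelTorusCensusEta (nKT one_le_nKT one_le_torusSupNorm_sub)
open B9GeoNormsKLevelV1 (geo9K)
open B9Thm34Ext (toB6)
open B9Thm39ReadingCoords (cR39 cR39_nonneg coordBound39 basisBound39)
open B11SectG (BlockNorm HasMaj)
open B11SectGGlobal (Size)
open B11SectGGlobalSizes
open B9CoReadingCoords (XBK)
open B9CoReadingCoordsS (XSK sIK sIK_level)
open B9Eq340NearPairBlocks (near_levels near_dist_carrier_le)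
open B9GradViaDivLettersAtPins (JcoKH rJ dist_bI_sIK_shift_le supDist_shift_le_one abs_JcoKH_apply_le)
open B9GradViaDivLettersAtPinsHolderPairs (torusSupNorm_chartY_sub tpar_eq abs_JcoKH_sub_le JcoKH_apply_of_dir_ne sIK_chartY shift_injective')
open B9MultiscaleSmoothPartitionY (scl scl_pos NearY levY_window levY_window_of_nearY levY_eq_blkOf)
open B9MultiscaleSmoothPartitionYLip (CLip)
open B9SmoothHolderClassS (bHZ bHZ_loc bHZ_isLoc_iff Wscl Wscl_nonneg Wscl_mono one_le_Wscl scl_div_nKT_pos_le_one NearPair wEta wEta_nonneg)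
open B9SmoothHolderClassK (bHZK bHZK_loc bHZK_isLoc_iff srcY NearPairK wEtaK wEtaK_nonneg wEtaK_eq src_ne_of_nearPairK blkV1_eq_blkOf_srcY)
open Node00 (SiteY FBondY IBondY CfgY toKT levY)
open Node00.OpsYNablaBridge (chartY chartY_eq)

variable {𝔸 : Type} [NormedRing 𝔸] [NormedAlgebra ℂ 𝔸] [CompleteSpace 𝔸]
variable {d ℓ : ℕ} {hd : 1 ≤ d + 1} {hL : Odd (ℓ + 1) ∧ 1 < ℓ + 1} {b₀ b₁ : ℝ}
variable (i : KIdx d ℓ hd hL b₀ b₁)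
variable {κ : Type} [Fintype κ]

/-! ## §1 Scalar bookkeeping: the read site, its level, the weights against the sup weight of `y′` -/

section Scalars

/-- the READ SITE of `J_μ` at a bond: `chart(b₋ + e_μ)`. [cite: Balaban1985BackgroundPropagators, (3.3) p.390, dictionary] -/
def readZ (μ : Fin (d + 1)) (q : XBK κ i) : SiteY i := chartY i (q.1.src.shift μ)

omit [Fintype κ] in
/-- the read site is torus-adjacent to the source site. [cite: Balaban1984PropagatorsII, (2.1) p.224, bookkeeping] -/
theorem torusSupNorm_src_read_le_one (μ : Fin (d + 1)) (q : XBK κ i) : torusSupNorm (toKT i).NB ((srcY i q).1 - (readZ i μ q).1) ≤ 1 := by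
  rw [srcY, readZ, torusSupNorm_chartY_sub]
  exact_mod_cast supDist_shift_le_one i q.1.src μ

omit [Fintype κ] in
/-- hence the levels of the source and the read site differ by at most one. [cite: Balaban1984PropagatorsII, (2.2) p.224] -/
theorem levY_src_read (μ : Fin (d + 1)) (q : XBK κ i) :
    levY i (srcY i q) ≤ levY i (readZ i μ q) + 1 ∧ levY i (readZ i μ q) ≤ levY i (srcY i q) + 1 := by
  have h1 : (1 : ℝ) ≤ 6 * (((ℓ + 1 : ℕ) : ℝ)) ^ levY i (readZ i μ q) := by
    have : (1 : ℝ) ≤ (((ℓ + 1 : ℕ) : ℝ)) ^ levY i (readZ i μ q) := one_le_pow₀ (by exact_mod_cast Nat.succ_le_succ (Nat.zero_le ℓ))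
    linarith
  have h := levY_window i ((torusSupNorm_src_read_le_one i μ q).trans h1)
  exact ⟨h.2, h.1⟩

omit [Fintype κ] in
/-- the level of the block of a fine bond is the level of its charted source site. [cite: Balaban1984PropagatorsII, (2.45) p.231, bookkeeping] -/
theorem blkV1_level_eq_levY (q : XBK κ i) : (blkV1 i.hN i.D q.1).1.1 = levY i (srcY i q) := by
  rw [blkV1_eq_blkOf_srcY, levY_eq_blkOf]

/-- `Wscl p` decreases by at most `L^{kp}` over `k` levels: `j(y′) ≤ j(y) + k ⇒ Wscl p y ≤ L^{kp}·Wscl p y′`. [cite: Balaban1984PropagatorsII, (2.1) p.224, bookkeeping] -/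
theorem Wscl_le_of_lvl_le {p : ℝ} (hp : 0 ≤ p) {y y' : IBondY i} {k : ℕ} (h : lvl i.hN i.D i.hk y' ≤ lvl i.hN i.D i.hk y + k) :
    Wscl i p y ≤ (((ℓ + 1 : ℕ) : ℝ)) ^ ((k : ℝ) * p) * Wscl i p y' := by
  have hL1 : (1 : ℝ) ≤ ((ℓ + 1 : ℕ) : ℝ) := by exact_mod_cast Nat.succ_le_succ (Nat.zero_le ℓ)
  have hL0 : (0 : ℝ) < ((ℓ + 1 : ℕ) : ℝ) := by positivity
  obtain ⟨h0, -⟩ := scl_div_nKT_pos_le_one i y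
  obtain ⟨h0', -⟩ := scl_div_nKT_pos_le_one i y'
  have hn : (0 : ℝ) < (nKT (toKT i) : ℝ) := by exact_mod_cast lt_of_lt_of_le Nat.zero_lt_one (one_le_nKT (toKT i))
  -- `scl y′ ≤ L^k · scl y`
  have hs : scl i y' ≤ (((ℓ + 1 : ℕ) : ℝ)) ^ k * scl i y := by
    rw [scl, scl, ← pow_add]; exact pow_le_pow_right₀ hL1 (by omega)
  -- `(scl y / n)⁻¹ ≤ L^k · (scl y′ / n)⁻¹`, then raise to the power `p`
  rw [Wscl, Wscl, ← Real.inv_rpow h0.le, ← Real.inv_rpow h0'.le]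
  have hbase : (scl i y / (nKT (toKT i) : ℝ))⁻¹ ≤ (((ℓ + 1 : ℕ) : ℝ)) ^ k * (scl i y' / (nKT (toKT i) : ℝ))⁻¹ := by
    rw [inv_div, inv_div, mul_div_assoc', div_le_div_iff₀ (scl_pos i y) (scl_pos i y')]
    calc (nKT (toKT i) : ℝ) * scl i y' ≤ (nKT (toKT i) : ℝ) * ((((ℓ + 1 : ℕ) : ℝ)) ^ k * scl i y) := mul_le_mul_of_nonneg_left hs hn.le
      _ = (((ℓ + 1 : ℕ) : ℝ)) ^ k * (nKT (toKT i) : ℝ) * scl i y := by ring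
  calc ((scl i y / (nKT (toKT i) : ℝ))⁻¹) ^ p ≤ ((((ℓ + 1 : ℕ) : ℝ)) ^ k * (scl i y' / (nKT (toKT i) : ℝ))⁻¹) ^ p :=
        Real.rpow_le_rpow (inv_nonneg.2 h0.le) hbase hp
    _ = ((((ℓ + 1 : ℕ) : ℝ)) ^ k) ^ p * ((scl i y' / (nKT (toKT i) : ℝ))⁻¹) ^ p := Real.mul_rpow (by positivity) (inv_nonneg.2 h0'.le)
    _ = (((ℓ + 1 : ℕ) : ℝ)) ^ ((k : ℝ) * p) * ((scl i y' / (nKT (toKT i) : ℝ))⁻¹) ^ p := by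
        rw [← Real.rpow_natCast, ← Real.rpow_mul hL0.le]

/-- the η-scale weight at a block scale `L^m` against the sup weight of `y′`: `m + k ≥ j(y′)` gives `((L^m ∕ Lᵏ)^ε)⁻¹ ≤ L^k·Wscl p y′` (`0 ≤ ε ≤ 1`, `ε ≤ p`).
[cite: Balaban1985BackgroundPropagators, (3.41) p.397 + (3.43) p.398, bookkeeping] -/
theorem pow_weight_le_Wscl {ε p : ℝ} (hε0 : 0 ≤ ε) (hε1 : ε ≤ 1) (hεp : ε ≤ p) {m k : ℕ} {y' : IBondY i} (h : lvl i.hN i.D i.hk y' ≤ m + k) :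
    (((((ℓ + 1 : ℕ) : ℝ)) ^ m / (nKT (toKT i) : ℝ)) ^ ε)⁻¹ ≤ (((ℓ + 1 : ℕ) : ℝ)) ^ k * Wscl i p y' := by
  have hL1 : (1 : ℝ) ≤ ((ℓ + 1 : ℕ) : ℝ) := by exact_mod_cast Nat.succ_le_succ (Nat.zero_le ℓ)
  have hn : (0 : ℝ) < (nKT (toKT i) : ℝ) := by exact_mod_cast lt_of_lt_of_le Nat.zero_lt_one (one_le_nKT (toKT i))
  have hm : (0 : ℝ) < (((ℓ + 1 : ℕ) : ℝ)) ^ m / (nKT (toKT i) : ℝ) := by positivity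
  obtain ⟨h0', h1'⟩ := scl_div_nKT_pos_le_one i y'
  -- `scl y′ / n ≤ L^k · (L^m / n)`
  have hs : scl i y' / (nKT (toKT i) : ℝ) ≤ (((ℓ + 1 : ℕ) : ℝ)) ^ k * ((((ℓ + 1 : ℕ) : ℝ)) ^ m / (nKT (toKT i) : ℝ)) := by
    rw [← mul_div_assoc, ← pow_add, scl]
    exact div_le_div_of_nonneg_right (pow_le_pow_right₀ hL1 (by omega)) hn.le
  -- hence `(scl y′/n)^ε ≤ L^{kε}·(L^m/n)^ε ≤ L^k·(L^m/n)^ε`, i.e. `((L^m/n)^ε)⁻¹ ≤ L^k·((scl y′/n)^ε)⁻¹`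
  have hkε : ((((ℓ + 1 : ℕ) : ℝ)) ^ k) ^ ε ≤ (((ℓ + 1 : ℕ) : ℝ)) ^ k := by
    have h1k : (1 : ℝ) ≤ (((ℓ + 1 : ℕ) : ℝ)) ^ k := one_le_pow₀ hL1
    calc ((((ℓ + 1 : ℕ) : ℝ)) ^ k) ^ ε ≤ ((((ℓ + 1 : ℕ) : ℝ)) ^ k) ^ (1 : ℝ) := Real.rpow_le_rpow_of_exponent_le h1k hε1
      _ = _ := Real.rpow_one _
  have hcmp : (scl i y' / (nKT (toKT i) : ℝ)) ^ ε ≤ (((ℓ + 1 : ℕ) : ℝ)) ^ k * ((((ℓ + 1 : ℕ) : ℝ)) ^ m / (nKT (toKT i) : ℝ)) ^ ε := by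
    calc (scl i y' / (nKT (toKT i) : ℝ)) ^ ε ≤ ((((ℓ + 1 : ℕ) : ℝ)) ^ k * ((((ℓ + 1 : ℕ) : ℝ)) ^ m / (nKT (toKT i) : ℝ))) ^ ε :=
          Real.rpow_le_rpow h0'.le hs hε0
      _ = ((((ℓ + 1 : ℕ) : ℝ)) ^ k) ^ ε * ((((ℓ + 1 : ℕ) : ℝ)) ^ m / (nKT (toKT i) : ℝ)) ^ ε := Real.mul_rpow (by positivity) hm.le
      _ ≤ _ := mul_le_mul_of_nonneg_right hkε (Real.rpow_nonneg hm.le _)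
  have hε' : ((((((ℓ + 1 : ℕ) : ℝ)) ^ m / (nKT (toKT i) : ℝ)) ^ ε)⁻¹) ≤ (((ℓ + 1 : ℕ) : ℝ)) ^ k * ((scl i y' / (nKT (toKT i) : ℝ)) ^ ε)⁻¹ := by
    have hA : 0 < (scl i y' / (nKT (toKT i) : ℝ)) ^ ε := Real.rpow_pos_of_pos h0' _
    have hB : 0 < ((((ℓ + 1 : ℕ) : ℝ)) ^ m / (nKT (toKT i) : ℝ)) ^ ε := Real.rpow_pos_of_pos hm _
    rw [inv_le_comm₀ hB (by positivity), mul_inv, inv_inv]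
    calc ((((ℓ + 1 : ℕ) : ℝ)) ^ k)⁻¹ * (scl i y' / (nKT (toKT i) : ℝ)) ^ ε
        ≤ ((((ℓ + 1 : ℕ) : ℝ)) ^ k)⁻¹ * ((((ℓ + 1 : ℕ) : ℝ)) ^ k * ((((ℓ + 1 : ℕ) : ℝ)) ^ m / (nKT (toKT i) : ℝ)) ^ ε) :=
          mul_le_mul_of_nonneg_left hcmp (by positivity)
      _ = _ := by field_simp
  exact hε'.trans (mul_le_mul_of_nonneg_left (Wscl_mono i hεp y') (by positivity))

end Scalars

/-! ## §2 The value and the pair term of `J_μλ` for a `λ` localised in the smooth class -/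

section Terms

variable [Fintype (geo9K i).Site]
variable (b : Module.Basis κ ℝ 𝔸) [FiniteDimensional ℝ 𝔸] (B : B9.Backgrounds) (cfg : B.Cfg → CfgY 𝔸 i)
variable {R : ℝ} {H : Prop} {ε p : ℝ}

open Classical in
/-- the `Δ̃(y′)`-sup of a site vector. [cite: Balaban1985BackgroundPropagators, (3.39) p.397 + (3.44) p.398, dictionary] -/
def SupZ (y' : IBondY i) (lam : XSK κ i → ℝ) : ℝ :=
  (Size.ofSup (toB6 (geo9K i) R H) (fun (q : XSK κ i) (y : IBondY i) => NearY i y q.1)).sz y' lam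

open Classical in
/-- the near-pair part of a site vector based in `Δ̃(y′)`. [cite: Balaban1985BackgroundPropagators, (3.40) p.397 + (3.44) p.398, dictionary] -/
def PairZ (ε : ℝ) (y' : IBondY i) (lam : XSK κ i → ℝ) : ℝ :=
  (Size.ofPairs (toB6 (geo9K i) R H) (fun (q : XSK κ i) (y : IBondY i) => NearY i y q.1) (NearPair i) (wEta i ε) (wEta_nonneg i ε)).sz y' lam

variable {i b B cfg}

omit [CompleteSpace 𝔸] [NormedAlgebra ℂ 𝔸] [NormedRing 𝔸] in
/-- a vector vanishing off `Δ̃(y′)` is pointwise below its `Δ̃(y′)`-sup. [cite: Balaban1985BackgroundPropagators, (3.44) p.398, bookkeeping] -/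
theorem abs_le_SupZ {y' : IBondY i} {lam : XSK κ i → ℝ} (hloc : ∀ q : XSK κ i, ¬ NearY i y' q.1 → lam q = 0) (q : XSK κ i) :
    |lam q| ≤ SupZ (R := R) (H := H) i y' lam := by
  classical
  by_cases hq : NearY i y' q.1
  · exact ofSup_abs_le _ hq lam
  · rw [hloc q hq, abs_zero]; exact Size.nonneg _ _ _

omit [CompleteSpace 𝔸] [NormedAlgebra ℂ 𝔸] [NormedRing 𝔸] in
/-- `0 ≤ SupZ`. [cite: Balaban1985BackgroundPropagators, (3.39) p.397, bookkeeping] -/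
theorem SupZ_nonneg (y' : IBondY i) (lam : XSK κ i → ℝ) : 0 ≤ SupZ (R := R) (H := H) i y' lam := Size.nonneg _ _ _

omit [CompleteSpace 𝔸] [NormedAlgebra ℂ 𝔸] [NormedRing 𝔸] in
/-- `0 ≤ PairZ`. [cite: Balaban1985BackgroundPropagators, (3.40) p.397, bookkeeping] -/
theorem PairZ_nonneg (y' : IBondY i) (lam : XSK κ i → ℝ) : 0 ≤ PairZ (R := R) (H := H) i ε y' lam := Size.nonneg _ _ _

omit [CompleteSpace 𝔸] [NormedAlgebra ℂ 𝔸] [NormedRing 𝔸] in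
/-- the local size of the source class unfolded: `loc_{y′} λ = Wscl p y′·SupZ + PairZ`. [cite: Balaban1985BackgroundPropagators, (3.44) p.398, bookkeeping] -/
theorem bHZ_loc_eq (hε0 : 0 ≤ ε) (hε1 : ε ≤ 1) (hεp : ε ≤ p) (y' : IBondY i) (lam : XSK κ i → ℝ) :
    (bHZ (κ := κ) i (R := R) (H := H) hε0 hε1 hεp).loc y' lam = Wscl i p y' * SupZ (R := R) (H := H) i y' lam + PairZ (R := R) (H := H) i ε y' lam := by
  unfold SupZ PairZ
  exact bHZ_loc i hε0 hε1 hεp y' lam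

omit [CompleteSpace 𝔸] [NormedAlgebra ℂ 𝔸] [NormedRing 𝔸] in
/-- the slice sums of a localised vector: `Σ_a |λ(z, ν, a, c′)| ≤ |κ|·SupZ`. [cite: Balaban1985BackgroundPropagators, (3.39) p.397, bookkeeping] -/
theorem sum_abs_le_card_SupZ {y' : IBondY i} {lam : XSK κ i → ℝ} (hloc : ∀ q : XSK κ i, ¬ NearY i y' q.1 → lam q = 0)
    (z : SiteY i) (ν : Fin (d + 1)) (c' : κ) : ∑ a, |lam (z, ν, a, c')| ≤ (Fintype.card κ : ℝ) * SupZ (R := R) (H := H) i y' lam := by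
  calc ∑ a, |lam (z, ν, a, c')| ≤ ∑ _a : κ, SupZ (R := R) (H := H) i y' lam := Finset.sum_le_sum fun a _ => abs_le_SupZ hloc _
    _ = _ := by rw [Finset.sum_const, nsmul_eq_mul, Finset.card_univ]

/-- ★ **THE VALUE**: `|J_μλ(b)| ≤ cR39·SupZ_{y′} λ` for a vector vanishing off `Δ̃(y′)` and contracting links. [cite: Balaban1985BackgroundPropagators, (3.3) p.390 + (3.44) p.398] -/
theorem abs_J_le_SupZ (μ : Fin (d + 1)) (U₁ : B.Cfg)
    (hU : ∀ (ν : Fin (d + 1)) (s : Site (PV d ℓ i.m i.K hd hL) 0), ‖(cfg U₁ ν s : 𝔸)‖ ≤ 1 ∧ ‖(((cfg U₁ ν s)⁻¹ : 𝔸ˣ) : 𝔸)‖ ≤ 1)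
    {y' : IBondY i} {lam : XSK κ i → ℝ} (hloc : ∀ q : XSK κ i, ¬ NearY i y' q.1 → lam q = 0) (q : XBK κ i) :
    |JcoKH i b B cfg μ U₁ lam q| ≤ cR39 b * SupZ (R := R) (H := H) i y' lam := by
  have hcb : 0 ≤ coordBound39 b := norm_nonneg _
  have hbb : 0 ≤ basisBound39 b := Finset.sum_nonneg fun _ _ => norm_nonneg _
  refine (abs_JcoKH_apply_le i b B cfg μ U₁ hU lam q).trans ?_
  calc coordBound39 b * (basisBound39 b * ∑ a, |lam (chartY i (q.1.src.shift μ), q.2.1, a, q.2.2.2)|)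
      ≤ coordBound39 b * (basisBound39 b * ((Fintype.card κ : ℝ) * SupZ (R := R) (H := H) i y' lam)) :=
        mul_le_mul_of_nonneg_left (mul_le_mul_of_nonneg_left (sum_abs_le_card_SupZ hloc _ _ _) hbb) hcb
    _ = cR39 b * SupZ (R := R) (H := H) i y' lam := by simp only [cR39]; ring

omit [Fintype (geo9K i).Site] in
/-- `J_μλ(b) ≠ 0` forces the read site into `Δ̃(y′)`. [cite: Balaban1985BackgroundPropagators, (3.3) p.390, bookkeeping] -/
theorem nearY_read_of_J_ne_zero (μ : Fin (d + 1)) (U₁ : B.Cfg)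
    (hU : ∀ (ν : Fin (d + 1)) (s : Site (PV d ℓ i.m i.K hd hL) 0), ‖(cfg U₁ ν s : 𝔸)‖ ≤ 1 ∧ ‖(((cfg U₁ ν s)⁻¹ : 𝔸ˣ) : 𝔸)‖ ≤ 1)
    {y' : IBondY i} {lam : XSK κ i → ℝ} (hloc : ∀ q : XSK κ i, ¬ NearY i y' q.1 → lam q = 0) {q : XBK κ i}
    (hq : JcoKH i b B cfg μ U₁ lam q ≠ 0) : NearY i y' (readZ i μ q) := by
  by_contra hn
  have h : |JcoKH i b B cfg μ U₁ lam q| ≤ coordBound39 b * (basisBound39 b * ∑ a, |lam (readZ i μ q, q.2.1, a, q.2.2.2)|) :=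
    abs_JcoKH_apply_le i b B cfg μ U₁ hU lam q
  have h0 : ∑ a, |lam (readZ i μ q, q.2.1, a, q.2.2.2)| = 0 :=
    Finset.sum_eq_zero fun a _ => by rw [hloc (readZ i μ q, q.2.1, a, q.2.2.2) hn, abs_zero]
  rw [h0, mul_zero, mul_zero] at h
  exact hq (abs_eq_zero.1 (le_antisymm h (abs_nonneg _)))

omit [CompleteSpace 𝔸] [NormedAlgebra ℂ 𝔸] [NormedRing 𝔸] in
/-- ★ **ONE SITE PAIR TERM**: for distinct charted sites `z, z′` and a vector vanishing off `Δ̃(y′)`, the η-weighted difference of one coordinate is below `PairZ + 2L·Wscl p y′·SupZ` —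
a near pair based in `Δ̃(y′)` (at `z` or at `z′`) is a term of `PairZ`; a far pair (beyond the base point's block scale) has weight `≤ L·Wscl p y′` and difference `≤ 2·SupZ`; a pair
with both values zero contributes nothing. [cite: Balaban1985BackgroundPropagators, (3.40) p.397 + (3.44) p.398; Balaban1984PropagatorsII, (2.137) p.247] -/
theorem weight_mul_abs_sub_le (hε0 : 0 ≤ ε) (hε1 : ε ≤ 1) (hεp : ε ≤ p) {y' : IBondY i} {lam : XSK κ i → ℝ}
    (hloc : ∀ q : XSK κ i, ¬ NearY i y' q.1 → lam q = 0) {z z' : SiteY i} (hne : z.1 ≠ z'.1) (s : Fin (d + 1) × κ × κ) :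
    wEta i ε (z, s) (z', s) * |lam (z, s) - lam (z', s)| ≤
      PairZ (R := R) (H := H) i ε y' lam + 2 * ((ℓ + 1 : ℕ) : ℝ) * (Wscl i p y' * SupZ (R := R) (H := H) i y' lam) := by
  classical
  have hL0 : (0 : ℝ) ≤ ((ℓ + 1 : ℕ) : ℝ) := Nat.cast_nonneg _
  have hW := Wscl_nonneg i p y'
  have hS := SupZ_nonneg (R := R) (H := H) (i := i) y' lam
  have hP := PairZ_nonneg (R := R) (H := H) (ε := ε) (i := i) y' lam
  have hw0 : 0 ≤ wEta i ε (z, s) (z', s) := wEta_nonneg i ε _ _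
  have hD : 0 < torusSupNorm (toKT i).NB (z.1 - z'.1) := lt_of_lt_of_le one_pos (one_le_torusSupNorm_sub (toKT i) (x := z') (x' := z) hne)
  have hn : (0 : ℝ) < (nKT (toKT i) : ℝ) := by exact_mod_cast lt_of_lt_of_le Nat.zero_lt_one (one_le_nKT (toKT i))
  have hrest : 0 ≤ PairZ (R := R) (H := H) i ε y' lam + 2 * ((ℓ + 1 : ℕ) : ℝ) * (Wscl i p y' * SupZ (R := R) (H := H) i y' lam) := by positivity
  -- symmetric form of the weight
  have hwsymm : wEta i ε (z', s) (z, s) = wEta i ε (z, s) (z', s) := by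
    simp only [wEta]
    rw [show z'.1 - z.1 = -(z.1 - z'.1) by abel, B6Geom246MultiLevelTorus.torusSupNorm_neg (fun μ => one_le_N0 (toKT i).hMh (toKT i).hP μ)]
  -- the far-pair weight bound: beyond `L^{lev w}` from a base point `w ∈ Δ̃(y′)`, the weight is `≤ L·Wscl p y′`
  have hfar : ∀ {w : SiteY i}, NearY i y' w → (((ℓ + 1 : ℕ) : ℝ)) ^ levY i w < torusSupNorm (toKT i).NB (z.1 - z'.1) →
      wEta i ε (z, s) (z', s) ≤ ((ℓ + 1 : ℕ) : ℝ) * Wscl i p y' := by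
    intro w hw hlt
    have hwin := (levY_window_of_nearY i hw).1
    have hm : (0 : ℝ) < (((ℓ + 1 : ℕ) : ℝ)) ^ levY i w / (nKT (toKT i) : ℝ) := by positivity
    have hle : (((((ℓ + 1 : ℕ) : ℝ)) ^ levY i w / (nKT (toKT i) : ℝ)) ^ ε) ≤ (torusSupNorm (toKT i).NB (z.1 - z'.1) / (nKT (toKT i) : ℝ)) ^ ε :=
      Real.rpow_le_rpow hm.le (div_le_div_of_nonneg_right hlt.le hn.le) hε0
    calc wEta i ε (z, s) (z', s) ≤ (((((ℓ + 1 : ℕ) : ℝ)) ^ levY i w / (nKT (toKT i) : ℝ)) ^ ε)⁻¹ := inv_anti₀ (Real.rpow_pos_of_pos hm _) hle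
      _ ≤ (((ℓ + 1 : ℕ) : ℝ)) ^ 1 * Wscl i p y' := pow_weight_le_Wscl i hε0 hε1 hεp (by omega)
      _ = _ := by rw [pow_one]
  have habs2 : |lam (z, s) - lam (z', s)| ≤ 2 * SupZ (R := R) (H := H) i y' lam :=
    (abs_sub _ _).trans (by linarith [abs_le_SupZ (R := R) (H := H) hloc (z, s), abs_le_SupZ (R := R) (H := H) hloc (z', s)])
  by_cases hz : NearY i y' z
  · by_cases hclose : torusSupNorm (toKT i).NB (z.1 - z'.1) ≤ (((ℓ + 1 : ℕ) : ℝ)) ^ levY i z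
    · -- a near pair based at `z ∈ Δ̃(y′)`: a term of `PairZ`
      have hP' : NearPair i (z, s) (z', s) := ⟨hne, hclose, rfl⟩
      exact (ofPairs_term_le _ _ _ _ (show NearY i y' (z, s).1 from hz) hP' lam).trans (le_add_of_nonneg_right (by positivity))
    · push Not at hclose
      calc wEta i ε (z, s) (z', s) * |lam (z, s) - lam (z', s)| ≤ (((ℓ + 1 : ℕ) : ℝ) * Wscl i p y') * (2 * SupZ (R := R) (H := H) i y' lam) :=
            mul_le_mul (hfar hz hclose) habs2 (abs_nonneg _) (mul_nonneg hL0 hW)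
        _ = 2 * ((ℓ + 1 : ℕ) : ℝ) * (Wscl i p y' * SupZ (R := R) (H := H) i y' lam) := by ring
        _ ≤ _ := le_add_of_nonneg_left hP
  · by_cases hz' : NearY i y' z'
    · by_cases hclose : torusSupNorm (toKT i).NB (z'.1 - z.1) ≤ (((ℓ + 1 : ℕ) : ℝ)) ^ levY i z'
      · have hP' : NearPair i (z', s) (z, s) := ⟨hne.symm, hclose, rfl⟩
        rw [← hwsymm, abs_sub_comm]
        exact (ofPairs_term_le _ _ _ _ (show NearY i y' (z', s).1 from hz') hP' lam).trans (le_add_of_nonneg_right (by positivity))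
      · push Not at hclose
        rw [show z'.1 - z.1 = -(z.1 - z'.1) by abel, B6Geom246MultiLevelTorus.torusSupNorm_neg (fun μ => one_le_N0 (toKT i).hMh (toKT i).hP μ)] at hclose
        calc wEta i ε (z, s) (z', s) * |lam (z, s) - lam (z', s)| ≤ (((ℓ + 1 : ℕ) : ℝ) * Wscl i p y') * (2 * SupZ (R := R) (H := H) i y' lam) :=
              mul_le_mul (hfar hz' hclose) habs2 (abs_nonneg _) (mul_nonneg hL0 hW)
          _ = 2 * ((ℓ + 1 : ℕ) : ℝ) * (Wscl i p y' * SupZ (R := R) (H := H) i y' lam) := by ring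
          _ ≤ _ := le_add_of_nonneg_left hP
    · rw [hloc (z, s) hz, hloc (z', s) hz', sub_zero, abs_zero, mul_zero]
      exact hrest

end Terms

/-! ## §3 ★★ The letter between the smooth classes -/

section Letter

variable [Fintype (geo9K i).Site]
variable (b : Module.Basis κ ℝ 𝔸) [FiniteDimensional ℝ 𝔸] (B : B9.Backgrounds) (cfg : B.Cfg → CfgY 𝔸 i)
variable {bI : FBondY i → IBondY i}

/-- the constant of the letter: `L^{4p} + 2ϑL² + 2L + 1`. OURS. [cite: Balaban1985BackgroundPropagators, (3.44) p.398, dictionary] -/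
def CJZ (ℓ : ℕ) (p ϑ : ℝ) : ℝ := (((ℓ + 1 : ℕ) : ℝ)) ^ ((4 : ℝ) * p) + 2 * ϑ * (((ℓ + 1 : ℕ) : ℝ)) ^ 2 + 2 * ((ℓ + 1 : ℕ) : ℝ) + 1

/-- the radius of the letter: `2r + 2·rJ` (the two enlargement radii, one admissible pair, one read-site shift). OURS. [cite: Balaban1984PropagatorsII, (2.46) p.231 + (2.54) p.232, dictionary] -/
def rZ (d ℓ : ℕ) (r : ℝ) : ℝ := 2 * r + 2 * rJ d ℓ

omit [Fintype κ] [Fintype (geo9K i).Site] in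
/-- ★ **THE GEOMETRY OF ONE CONTRIBUTION**: if a bond `q` has its source in `Δ̃(y)`, `q′` is `q` or admissible to it, and the read site of `q′` lies in `Δ̃(y′)`, then `d(y, y′) ≤ rZ` and
`j(y′) ≤ j(y) + 4` (for 1-faithful, direction-blind `bI` and the displayed enlargement radius `r`). [cite: Balaban1984PropagatorsII, (2.2) p.224 + (2.46) p.231 + (2.54) p.232; Balaban1985BackgroundPropagators, (3.40) p.397] -/
theorem dist_lvl_of_seen (hβ1 : ∀ f : FBondY i, (geomT i.D).dist (β i.hN i.D i.hk (bI f)) (blkV1 i.hN i.D f) ≤ 1)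
    (hbI0 : ∀ f : FBondY i, bI f = bI ⟨f.src, 0⟩) {r : ℝ} (hN : ∀ (y : IBondY i) (z : SiteY i), NearY i y z → (geo9K i).dist y (sIK i bI z) ≤ r)
    (μ : Fin (d + 1)) {y y' : IBondY i} {q q' : XBK κ i} (hy : NearY i y (srcY i q)) (hqq : q' = q ∨ NearPairK i q q')
    (hy' : NearY i y' (readZ i μ q')) : (geo9K i).dist y y' ≤ rZ d ℓ r ∧ lvl i.hN i.D i.hk y' ≤ lvl i.hN i.D i.hk y + 4 := by
  obtain ⟨htri, hrefl, hnn⟩ := triangle_refl_nonneg_T i.D (le_trans (by norm_num) i.hM8) (fun μ => le_trans (by norm_num) (i.hP5 μ))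
  have hdist : ∀ a c : IBondY i, (geo9K i).dist a c = (geomT i.D).dist (β i.hN i.D i.hk a) (β i.hN i.D i.hk c) := fun _ _ => rfl
  have hsymm : ∀ a c : IBondY i, (geo9K i).dist a c = (geo9K i).dist c a := fun a c => by
    rw [hdist, hdist]; exact B9Eq340NearPairBlocks.distT_comm i _ _
  -- the carrier bond of the source site IS `bI q.1` (direction-blind `bI`)
  have hsrc : sIK i bI (srcY i q) = bI q.1 := by
    rw [srcY, sIK_chartY, ← hbI0 q.1]
  have hsrc' : sIK i bI (srcY i q') = bI q'.1 := by
    rw [srcY, sIK_chartY, ← hbI0 q'.1]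
  -- hop 1: `y` to `bI q.1`
  have h1 : (geo9K i).dist y (bI q.1) ≤ r := by rw [← hsrc]; exact hN y _ hy
  -- hop 2: `bI q.1` to `bI q′.1` (admissible or equal)
  have hrJ : ((d : ℝ) + 1) * (((ℓ : ℝ) + 1) + 1) + 2 = rJ d ℓ := rfl
  have h2 : (geo9K i).dist (bI q.1) (bI q'.1) ≤ rJ d ℓ := by
    rcases hqq with rfl | hP
    · rw [hdist, hrefl]; unfold rJ; positivity
    · have hadm := hP.2.1
      have h := near_dist_carrier_le i hβ1 (x := q.1) (x' := q'.1) hadm.2.1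
      rw [hrJ] at h
      exact h
  -- hop 3: `bI q′.1` to the carrier of the read site of `q′`
  have h3 : (geo9K i).dist (bI q'.1) (sIK i bI (readZ i μ q')) ≤ rJ d ℓ := by
    have h := dist_bI_sIK_shift_le i hβ1 q'.1.src μ q'.1.dir
    exact h
  -- hop 4: the read site's carrier to `y′`
  have h4 : (geo9K i).dist (sIK i bI (readZ i μ q')) y' ≤ r := by rw [hsymm]; exact hN y' _ hy'
  have hrZ : (geo9K i).dist y y' ≤ rZ d ℓ r := by
    have t1 := htri (β i.hN i.D i.hk y) (β i.hN i.D i.hk (bI q.1)) (β i.hN i.D i.hk y')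
    have t2 := htri (β i.hN i.D i.hk (bI q.1)) (β i.hN i.D i.hk (bI q'.1)) (β i.hN i.D i.hk y')
    have t3 := htri (β i.hN i.D i.hk (bI q'.1)) (β i.hN i.D i.hk (sIK i bI (readZ i μ q'))) (β i.hN i.D i.hk y')
    rw [← hdist] at t1 t2 t3
    simp only [← hdist] at t1 t2 t3
    unfold rZ; linarith
  -- levels: `j(y′) ≤ lev(read q′) + 1 ≤ lev(src q′) + 2 ≤ lev(src q) + 3 ≤ j(y) + 4`
  have l1 := (levY_window_of_nearY i hy').1
  have l2 := (levY_src_read i μ q').2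
  have l3 : levY i (srcY i q') ≤ levY i (srcY i q) + 1 := by
    rcases hqq with rfl | hP
    · omega
    · have h := (near_levels i (x := q.1) (x' := q'.1) hP.2.1.2.1).1
      rw [blkV1_level_eq_levY, blkV1_level_eq_levY] at h
      exact h
  have l4 := (levY_window_of_nearY i hy).2
  exact ⟨hrZ, by omega⟩

end Letter

end Literature.MathematicalPhysics.QuantumFieldTheory.Balaban1983to89.B9GradViaDivLettersSmoothTerms
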